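import Literature.Topology.FourManifolds.SurfaceGroupGeneratorImages
import Mathlib.Algebra.BigOperators.Group.List.Basic
import Mathlib.Tactic.Group
import HarnessLib

/-!
# The reflection automorphism of the surface group `S_g`

Topic `Literature/Topology/FourManifolds`; companion of `SurfaceGroupCyclicShift.lean`, written for the
Dehn–Nielsen–Baer seat (`DehnNielsenBaerSurface.lean`).  The reflection `σ : (x, y, z) ↦ (x, -y, z)` of the
flower surface `Z_g` fixes the `a`-loop of the standard sector and reverses its `b`-loop
(`FlowerReflectionLoops.lean`), carries the `k`-th slice onto the `(-k)`-th, and moves the access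
path `γ` of the base point across the lens hole; on the melon marking it is therefore expected to
be (up to an inner automorphism) **the involution**

  `a_k ↦ b_{-k} a_{-k} b_{-k}⁻¹`, `b_k ↦ b_{-k}⁻¹`  (indices mod `g`),

which IS an automorphism of `S_g = ⟨a, b ∣ ∏_k [a_k, b_k]⟩`: handle by handle
`[b a b⁻¹, b⁻¹] = b a b⁻¹ a⁻¹ = [a, b]⁻¹`, so the relator goes to
`[a_0,b_0]⁻¹ [a_{g-1},b_{g-1}]⁻¹ ⋯ [a_1,b_1]⁻¹`, a cyclic rotation of the inverse relator.  (The naive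
candidate `a_k ↦ a_{-k}`, `b_k ↦ b_{-k}⁻¹` does NOT descend: for `g = 2` the image of the relator is
a reduced word of length two in the amalgam `F(a₀,b₀) *_ℤ F(a₁,b₁)`.)

* `SurfaceGroup.negFin`, `negFin_negFin` — the index involution `k ↦ -k (mod g)`;
* `SurfaceGroup.reflGens`, `relFactor_reflGens`, `prod_relFactor_reflGens` — the generator images
  kill the relator;
* `SurfaceGroup.reflEquiv g : S_g ≃* S_g` (an involution: `reflEquiv_reflEquiv`), with
  `reflEquiv_a`, `reflEquiv_b`.

Everything is proved; no named facts (D-0026).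

## References

* H. Zieschang, E. Vogt, H.-D. Coldewey, *Surfaces and Planar Discontinuous Groups*, LNM 835 (1980),
  §3.2 (the symmetries of the canonical polygon on the canonical generators). [ZieschangVogtColdewey1980]
* B. Farb, D. Margalit, *A primer on mapping class groups* (2012), Thm. 8.1. [FarbMargalit2012]
-/

noncomputable section

namespace Literature.Topology.FourManifolds

namespace SurfaceGroup

variable {g : ℕ}

/-! ### §1 The index involution -/

/-- The index involution `k ↦ -k (mod g)` on `Fin g`. [folklore] -/
def negFin (k : Fin g) : Fin g := ⟨(g - k) % g, Nat.mod_lt _ k.pos⟩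

/-- `negFin k` as a natural number. [folklore] -/
@[simp] theorem val_negFin (k : Fin g) : (negFin k : ℕ) = (g - k) % g := rfl

/-- `-(-k) = k`. [folklore] -/
@[simp] theorem negFin_negFin (k : Fin g) : negFin (negFin k) = k := by
  apply Fin.ext
  have hk : (k : ℕ) < g := k.2
  rw [val_negFin, val_negFin]
  rcases Nat.eq_zero_or_pos k with h0 | hpos
  · rw [h0, Nat.sub_zero, Nat.mod_self, Nat.sub_zero, Nat.mod_self]
  · rw [Nat.mod_eq_of_lt (by omega : g - k < g), Nat.sub_sub_self hk.le, Nat.mod_eq_of_lt hk]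

/-! ### §2 The generator images -/

/-- **The generator images of the reflection**: `a_k ↦ b_{-k} a_{-k} b_{-k}⁻¹`, `b_k ↦ b_{-k}⁻¹`.
[folklore] -/
def reflGens (g : ℕ) (p : surfaceGen g) : SurfaceGroup g :=
  cond p.2 (b (negFin p.1))⁻¹ (b (negFin p.1) * a (negFin p.1) * (b (negFin p.1))⁻¹)

/-- `reflGens` on `a_k`. [folklore] -/
@[simp] theorem reflGens_false (k : Fin g) :
    reflGens g (k, false) = b (negFin k) * a (negFin k) * (b (negFin k))⁻¹ := rfl

/-- `reflGens` on `b_k`. [folklore] -/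
@[simp] theorem reflGens_true (k : Fin g) : reflGens g (k, true) = (b (negFin k))⁻¹ := rfl

/-- **Handle by handle the reflection inverts the commutator**: `[b a b⁻¹, b⁻¹] = [a, b]⁻¹`. [folklore] -/
theorem relFactor_reflGens (k : Fin g) :
    relFactor (reflGens g) k =
      (relFactor (fun p => (PresentedGroup.of p : SurfaceGroup g)) (negFin k))⁻¹ := by
  rw [relFactor_fin, relFactor_fin, reflGens_false, reflGens_true]
  simp only [mul_inv_rev, inv_inv, a, b]
  group

/-- The list of the reflected commutators of the handles `1, …, n` of `S_{n+1}` is the reversed list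
of the inverses of their commutators. [folklore] -/
theorem map_relFactor_reflGens_succ (n : ℕ) :
    (List.range n).map (fun j => relFactor (reflGens (n + 1)) (j + 1)) =
      (((List.range n).map fun j =>
        relFactor (fun p => (PresentedGroup.of p : SurfaceGroup (n + 1))) (j + 1)).map
          (fun x => x⁻¹)).reverse := by
  refine List.ext_getElem (by simp) fun i h₁ h₂ => ?_
  rw [List.length_map, List.length_range] at h₁
  simp only [List.getElem_map, List.getElem_range, List.getElem_reverse, List.length_map,
    List.length_range]
  rw [show (i + 1 : ℕ) = ((⟨i + 1, by omega⟩ : Fin (n + 1)) : ℕ) from rfl, relFactor_reflGens]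
  congr 2
  rw [val_negFin]
  dsimp only
  rw [Nat.mod_eq_of_lt (by omega)]
  omega

/-- **The reflected images kill the relator.** [folklore] -/
theorem prod_relFactor_reflGens (g : ℕ) :
    ((List.range g).map (relFactor (reflGens g))).prod = 1 := by
  cases g with
  | zero => simp
  | succ n =>
    have hstd := prod_relFactor_of (g := n + 1)
    rw [List.range_succ_eq_map, List.map_cons, List.map_map, List.prod_cons] at hstd ⊢
    have h0 : relFactor (reflGens (n + 1)) 0 =
        (relFactor (fun p => (PresentedGroup.of p : SurfaceGroup (n + 1))) 0)⁻¹ := by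
      rw [show (0 : ℕ) = ((0 : Fin (n + 1)) : ℕ) from rfl, relFactor_reflGens]
      congr 2
      simp
    have hcomp : (relFactor (reflGens (n + 1)) ∘ Nat.succ) =
        fun j => relFactor (reflGens (n + 1)) (j + 1) := rfl
    have hcomp' : (relFactor (fun p => (PresentedGroup.of p : SurfaceGroup (n + 1))) ∘ Nat.succ) =
        fun j => relFactor (fun p => (PresentedGroup.of p : SurfaceGroup (n + 1))) (j + 1) := rfl
    rw [hcomp, map_relFactor_reflGens_succ, h0, ← List.prod_inv_reverse]
    rw [hcomp'] at hstd
    rw [eq_inv_of_mul_eq_one_left hstd, inv_inv, mul_inv_cancel]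

/-! ### §3 The reflection automorphism -/

/-- `reflGens` applied twice on a generator gives the generator back. [folklore] -/
theorem homOfGens_reflGens_reflGens (p : surfaceGen g) :
    homOfGens (reflGens g) (prod_relFactor_reflGens g) (reflGens g p) = PresentedGroup.of p := by
  obtain ⟨k, c⟩ := p
  cases c
  · rw [reflGens_false, map_mul, map_mul, map_inv, homOfGens_a, homOfGens_b, reflGens_false,
      reflGens_true, negFin_negFin]
    simp only [inv_inv, a, b]
    group
  · rw [reflGens_true, map_inv, homOfGens_b, reflGens_true, negFin_negFin, inv_inv]
    rfl

/-- **The reflection automorphism `a_k ↦ b_{-k} a_{-k} b_{-k}⁻¹`, `b_k ↦ b_{-k}⁻¹` of `S_g`**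
(an involution). [cite: ZieschangVogtColdewey1980, §3.2] -/
def reflEquiv (g : ℕ) : SurfaceGroup g ≃* SurfaceGroup g :=
  equivOfGens (reflGens g) (reflGens g) (prod_relFactor_reflGens g) (prod_relFactor_reflGens g)
    homOfGens_reflGens_reflGens homOfGens_reflGens_reflGens

/-- `reflEquiv` on a generator. [folklore] -/
@[simp] theorem reflEquiv_of (g : ℕ) (p : surfaceGen g) :
    reflEquiv g (PresentedGroup.of p) = reflGens g p :=
  equivOfGens_of _ _ _ _ _ _ p

/-- `reflEquiv` on `a_k`. [folklore] -/
theorem reflEquiv_a (k : Fin g) :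
    reflEquiv g (a k) = b (negFin k) * a (negFin k) * (b (negFin k))⁻¹ :=
  reflEquiv_of g (k, false)

/-- `reflEquiv` on `b_k`. [folklore] -/
theorem reflEquiv_b (k : Fin g) : reflEquiv g (b k) = (b (negFin k))⁻¹ :=
  reflEquiv_of g (k, true)

/-- **The reflection automorphism is an involution.** [folklore] -/
theorem reflEquiv_reflEquiv (g : ℕ) (x : SurfaceGroup g) : reflEquiv g (reflEquiv g x) = x := by
  suffices h : (reflEquiv g).toMonoidHom.comp (reflEquiv g).toMonoidHom = MonoidHom.id _ from
    DFunLike.congr_fun h x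
  refine PresentedGroup.ext fun p => ?_
  simp only [MonoidHom.comp_apply, MulEquiv.coe_toMonoidHom, MonoidHom.id_apply, reflEquiv_of]
  exact homOfGens_reflGens_reflGens p

end SurfaceGroup

end Literature.Topology.FourManifolds

end
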